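import Summits.Ventures.PercRepro.RankLevelSetUpFiveDegree
import Summits.Ventures.PercRepro.RankLevelSetUpFiveUseful
import Summits.Ventures.PercRepro.RankLevelSetUpFiveCount

/-! # RankLevelSetUpFiveSimple — ON A SIMPLE MATROID EVERY BAD MEMBER HAS AT LEAST SIX TYPE-B TARGETS
(night-1 g44; dossier §56.5; on the g41 modules `RankLevelSetUpFiveDegree` / `…Useful` / `…Count`)

The swap count of §56.5 for the 12-element case of the residue (P) on a SIMPLE `N = M✶` (no two parallel elements):
a hyperplane `cl R` not containing the rank-`2` set `L'` meets its line in a flat of rank `≤ 1`, which on a simple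
matroid is at most ONE point (**`ncard_closure_inter_closure_le_one`**, **`ncard_inter_closure_le_one`**), so every
coloop `c` has `#Λ(W, c) ≥ #L' − 1` admissible line points (**`ncard_lambda_ge_of_simple`**); with the useful
coloop of `exists_useful_coloop` (g41) — valid, and off `cl R` whenever `L' ⊆ cl R`, where all line points are
admissible — a bad member with `#L' = 4` has a valid coloop with `≥ 3` admissible points
(**`exists_valid_coloop_three_points`**) and hence, by `ncard_typeBTargets_ge`, at least `3 · 2 = 6` type-B targets
`(Z, t)` (**`six_le_ncard_typeBTargets_of_simple`**). Every declaration has a docstring; imports: the cell's own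
modules and Mathlib only. Axioms: standard. -/

namespace PercRepro

open Set Matroid

variable {α : Type}

/-! ## Rank-2 sets in a simple matroid -/

/-- **Two distinct non-parallel nonloops have rank `2`**: a set of more than one nonloop, no two of which are
parallel, has rank at least `2` (a set of rank `1` lies in the closure of one of its nonloops). -/
lemma two_le_eRk_of_one_lt_ncard_of_simple {N : Matroid α} [N.Finite] {X : Set α} (hXE : X ⊆ N.E)
    (hnl : ∀ e ∈ X, N.IsNonloop e) (hs : ∀ p ∈ X, ∀ q ∈ X, p ≠ q → q ∉ N.closure {p})
    (hX : 1 < X.ncard) : 2 ≤ N.eRk X := by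
  classical
  have hXfin : X.Finite := N.ground_finite.subset hXE
  by_contra hlt
  have hlt2 : N.eRk X < 2 := not_le.mp hlt
  rw [← one_add_one_eq_two] at hlt2
  have hle1 : N.eRk X ≤ 1 := Order.le_of_lt_add_one hlt2
  obtain ⟨u, hu⟩ : X.Nonempty := by
    rw [← Set.ncard_pos hXfin]; omega
  have h1 : (1 : ℕ∞) ≤ N.eRk X := by
    rw [← (hnl u hu).eRk_eq]
    exact N.eRk_mono (Set.singleton_subset_iff.mpr hu)
  have heq : N.eRk X = 1 := le_antisymm hle1 h1
  obtain ⟨e, heX, -, hsub⟩ := (Matroid.eRk_eq_one_iff hXE).mp heq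
  have hrest : 0 < (X \ {e}).ncard := by
    rw [Set.ncard_sdiff_singleton_of_mem heX]; omega
  obtain ⟨q, hq⟩ := (Set.ncard_pos (hXfin.subset Set.sdiff_subset)).mp hrest
  have hqe : q ≠ e := by simpa using hq.2
  exact hs e heX q hq.1 hqe.symm (hsub hq.1)

/-- **A closure not containing a rank-`≤ 2` set `L'` of nonloops of a simple matroid contains at most one point of
`cl L'`**: `cl L' ∩ cl R` is a flat of rank `≤ 1`, and a rank-`≤ 1` set of pairwise non-parallel nonloops has at
most one element. -/
lemma ncard_closure_inter_closure_le_one {N : Matroid α} [N.Finite] {L' R : Set α} (hLE : L' ⊆ N.E)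
    (hnl : ∀ e ∈ N.E, N.IsNonloop e) (hs : ∀ p ∈ N.E, ∀ q ∈ N.E, p ≠ q → q ∉ N.closure {p})
    (hL2 : N.eRk L' ≤ 2) (hLH : ¬ L' ⊆ N.closure R) : (N.closure L' ∩ N.closure R).ncard ≤ 1 := by
  by_contra hcon
  set X := N.closure L' ∩ N.closure R with hX
  have hXE : X ⊆ N.E := Set.inter_subset_left.trans (N.closure_subset_ground L')
  have h2 : 2 ≤ N.eRk X :=
    two_le_eRk_of_one_lt_ncard_of_simple hXE (fun e he => hnl e (hXE he))
      (fun p hp q hq => hs p (hXE hp) q (hXE hq)) (not_le.mp hcon)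
  have hXL : X ⊆ N.closure L' := Set.inter_subset_left
  have hrk : N.eRk (N.closure L') ≤ N.eRk X := by
    rw [N.eRk_closure_eq]; exact hL2.trans h2
  have hcl : N.closure X = N.closure (N.closure L') :=
    (N.isRkFinite_of_finite (N.ground_finite.subset hXE)).closure_eq_closure_of_subset_of_eRk_ge_eRk hXL hrk
  rw [N.closure_closure] at hcl
  apply hLH
  intro x hx
  have hx' : x ∈ N.closure X := by rw [hcl]; exact N.subset_closure _ hLE hx
  have hXR : N.closure X ⊆ N.closure R := by
    have : X ⊆ N.closure R := Set.inter_subset_right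
    exact N.closure_subset_closure_of_subset_closure this
  exact hXR hx'

/-- **A closure not containing a rank-`≤ 2` set of a simple matroid meets it in at most one point.** -/
lemma ncard_inter_closure_le_one {N : Matroid α} [N.Finite] {L' R : Set α} (hLE : L' ⊆ N.E)
    (hnl : ∀ e ∈ N.E, N.IsNonloop e) (hs : ∀ p ∈ N.E, ∀ q ∈ N.E, p ≠ q → q ∉ N.closure {p})
    (hL2 : N.eRk L' ≤ 2) (hLH : ¬ L' ⊆ N.closure R) : (L' ∩ N.closure R).ncard ≤ 1 := by
  have h := ncard_closure_inter_closure_le_one hLE hnl hs hL2 hLH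
  refine le_trans (Set.ncard_le_ncard ?_ (N.ground_finite.subset
    (Set.inter_subset_left.trans (N.closure_subset_ground L')))) h
  exact Set.inter_subset_inter_left _ (N.subset_closure L' hLE)

/-- **THE DEGREE BOUND ON A SIMPLE MATROID**: for a rank-`≤ 2` set `L'` of nonloops not inside `H = cl R`, every `c`
has `#Λ(W, c) = #{ℓ ∈ L' : {ℓ, c} ⊄ H} ≥ #L' − 1`. -/
lemma ncard_lambda_ge_of_simple {N : Matroid α} [N.Finite] {L' R : Set α} (hLE : L' ⊆ N.E)
    (hnl : ∀ e ∈ N.E, N.IsNonloop e) (hs : ∀ p ∈ N.E, ∀ q ∈ N.E, p ≠ q → q ∉ N.closure {p})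
    (hL2 : N.eRk L' ≤ 2) (hLH : ¬ L' ⊆ N.closure R) (c : α) :
    L'.ncard - 1 ≤ {ℓ ∈ L' | ¬ ({ℓ, c} ⊆ N.closure R)}.ncard := by
  have hfin : L'.Finite := N.ground_finite.subset hLE
  have h1 : (L' \ N.closure R).ncard ≤ {ℓ ∈ L' | ¬ ({ℓ, c} ⊆ N.closure R)}.ncard :=
    Set.ncard_le_ncard (lambda_superset L' R c) (hfin.subset (fun x hx => hx.1))
  have h2 : (L' \ N.closure R).ncard = L'.ncard - (L' ∩ N.closure R).ncard := by
    have := Set.ncard_inter_add_ncard_sdiff_eq_ncard L' (N.closure R) hfin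
    omega
  have h3 := ncard_inter_closure_le_one hLE hnl hs hL2 hLH
  omega

/-! ## A valid coloop with three admissible line points -/

/-- **Simplicity implies the absence of parallel triples** (the hypothesis form of the g41 lemmas). -/
lemma no_triple_of_simple {N : Matroid α} (hs : ∀ p ∈ N.E, ∀ q ∈ N.E, p ≠ q → q ∉ N.closure {p}) :
    ∀ p ∈ N.E, ∀ q ∈ N.E, ∀ r ∈ N.E, p ≠ q → p ≠ r → q ≠ r → q ∈ N.closure {p} → r ∉ N.closure {p} :=
  fun p hp q hq _ _ hpq _ _ hq' => absurd hq' (hs p hp q hq hpq)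

/-- **EVERY BAD MEMBER OF A SIMPLE MATROID HAS A VALID COLOOP WITH `≥ 3` ADMISSIBLE LINE POINTS** (night-1 g44,
§56.5): `N` of rank `5`, loopless and simple; `W` a base through `b`, `L'` of rank `2` with four elements and
`b ∉ cl L'`, the three coloops `c₁, c₂, c₃` with `rk (L' ∪ {c₁, c₂, c₃}) = 5`. Then some `c ∈ {c₁, c₂, c₃}` is valid
(`b ∉ cl (L' ∪ ({c₁,c₂,c₃} ∖ c))`) with `#Λ(W, c) ≥ 3`: the useful coloop of `exists_useful_coloop`, whose admissible
points are all of `L'` when `L' ⊆ cl (W ∖ b)` and at least `#L' − 1` of them otherwise. -/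
theorem exists_valid_coloop_three_points {N : Matroid α} [N.Finite] (h5 : N.eRank = 5)
    (hnl : ∀ e ∈ N.E, N.IsNonloop e) (hs : ∀ p ∈ N.E, ∀ q ∈ N.E, p ≠ q → q ∉ N.closure {p})
    {W : Set α} (hW : N.IsBase W) {b : α} (hb : b ∈ W) {L' : Set α} (hLE : L' ⊆ N.E) (hL : N.eRk L' = 2)
    (hL4 : L'.ncard = 4) (hbL : b ∉ N.closure L') {c₁ c₂ c₃ : α} (hc₁ : c₁ ∈ N.E) (hc₂ : c₂ ∈ N.E)
    (hc₃ : c₃ ∈ N.E) (hC : N.eRk (insert c₁ (insert c₂ (insert c₃ L'))) = 5) :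
    ∃ c ∈ ({c₁, c₂, c₃} : Set α), b ∉ N.closure (L' ∪ ({c₁, c₂, c₃} \ {c})) ∧
      3 ≤ {ℓ ∈ L' | ¬ ({ℓ, c} ⊆ N.closure (W \ {b}))}.ncard := by
  obtain ⟨c, hcC, hval, ℓ, hℓ, hℓc⟩ := exists_useful_coloop h5 hnl (no_triple_of_simple hs) hW hb hLE hL
    (by omega) hbL hc₁ hc₂ hc₃ hC
  refine ⟨c, hcC, hval, ?_⟩
  by_cases hLH : L' ⊆ N.closure (W \ {b})
  · have hcH : c ∉ N.closure (W \ {b}) := fun hc =>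
      hℓc (Set.insert_subset (hLH hℓ) (Set.singleton_subset_iff.mpr hc))
    rw [lambda_eq_of_notMem L' (W \ {b}) hcH, hL4]
    norm_num
  · have := ncard_lambda_ge_of_simple hLE hnl hs hL.le hLH c
    omega

/-- **SIX TYPE-B TARGETS** (night-1 g44, §56.5): under the hypotheses of `exists_valid_coloop_three_points`, with
`c₁, c₂, c₃` distinct and `{c₁, c₂, c₃}` and `W ∖ b` disjoint from `L'`, the bad member has at least six type-B
targets `(Z, t)` (`Z = (W ∖ b) ∪ {ℓ, c}`, `t ∈ {c₁,c₂,c₃} ∖ c`). -/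
theorem six_le_ncard_typeBTargets_of_simple {N : Matroid α} [N.Finite] (h5 : N.eRank = 5)
    (hnl : ∀ e ∈ N.E, N.IsNonloop e) (hs : ∀ p ∈ N.E, ∀ q ∈ N.E, p ≠ q → q ∉ N.closure {p})
    {W : Set α} (hW : N.IsBase W) {b : α} (hb : b ∈ W) {L' : Set α} (hLE : L' ⊆ N.E) (hL : N.eRk L' = 2)
    (hL4 : L'.ncard = 4) (hbL : b ∉ N.closure L') {c₁ c₂ c₃ : α} (hc₁ : c₁ ∈ N.E) (hc₂ : c₂ ∈ N.E)
    (hc₃ : c₃ ∈ N.E) (h12 : c₁ ≠ c₂) (h13 : c₁ ≠ c₃) (h23 : c₂ ≠ c₃)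
    (hC : N.eRk (insert c₁ (insert c₂ (insert c₃ L'))) = 5)
    (hCL : Disjoint ({c₁, c₂, c₃} : Set α) L') (hRL : Disjoint (W \ {b}) L') :
    6 ≤ (typeBTargets N (W \ {b}) L' {c₁, c₂, c₃} b).ncard := by
  classical
  obtain ⟨c, hcC, hval, h3⟩ := exists_valid_coloop_three_points h5 hnl hs hW hb hLE hL hL4 hbL hc₁ hc₂ hc₃ hC
  have hCE : ({c₁, c₂, c₃} : Set α) ⊆ N.E := by
    intro x hx
    rcases hx with rfl | rfl | rfl
    · exact hc₁
    · exact hc₂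
    · exact hc₃
  have hcard3 : ({c₁, c₂, c₃} : Set α).ncard = 3 := by
    rw [Set.ncard_insert_of_notMem (by simp [h12, h13]), Set.ncard_insert_of_notMem (by simp [h23]),
      Set.ncard_singleton]
  have hcard2 : (({c₁, c₂, c₃} : Set α) \ {c}).ncard = 2 := by
    rw [Set.ncard_sdiff_singleton_of_mem hcC, hcard3]
  have h := ncard_typeBTargets_ge hLE hCE hRL hCL hcC hval
  rw [hcard2] at h
  omega

end PercRepro
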